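import Summits.CriticalPhenomena.PercolationContinuityZ3.Theorems.PercNearOneGluingNoHeavyLowerTailSahiSunflowerSun5CertC
import Mathlib.Tactic.Positivity
import HarnessLib

/-!
# `NoHeavyLowerTail` (crux stmt-CriticalPhenomena-4575), master-family line P2: `Sun 5` — kernel-replayed domination identities (continued)

Support file (seat `prim-masterthm-p2`, gen 3; `--supports stmt-CriticalPhenomena-4575`); no named fact, no sorry.  Memo SAHI-ROUTE.md §4.12.
Part of the proof that on the sunflower poset `Sun 5` Sahi positivity of EVERY order is equivalent to the single top row `E_5(D_0,…,D_4) ≥ 0`: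
by the structure theorem (`…SahiSunflowerTower`) only the CO-SINGLETON families need a proof, and each satisfies an exact DOMINATION
IDENTITY `∏_{i=n−1}^{m−2}(i + a)·E_n(F) = E_m(row) + P`, `P` with nonnegative coefficients modulo `a + b + Σc = 1` (found and verified by two
independent programs, certs/domination_m5.json); replayed here in the KERNEL through prim-cert-2's reflection engine `…FaceCertKernel`
(`toPP/subCheckP/coeffsP`, `decide +kernel`) with the mass relation substituted symbolically (`SunCert.subst0`).
-/

namespace Summit.CriticalPhenomena.PercolationContinuityZ3.Theorems.SahiDeltaSystem
namespace Sun
open Lean.Grind.CommRing (Expr Context)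
open Finset Function Literature.Combinatorics.Sahi2008

set_option maxHeartbeats 2000000 in
set_option maxRecDepth 100000 in
/-- Co-singleton type 15 of `Sun 5` (index sets `[[0, 1, 2], [0, 1, 3], [0, 2, 3, 4], [1, 2, 3, 4]]`): `E_4 ≥ 0` from the top row, by the kernel-checked domination identity
`(3 + a)·E_4 = E_5(row) + P`, `P ≥ 0` (cell masses abbreviated by `ea, eb, e_j`; instantiate with `rfl`). [this work] -/
theorem co5_15 {ν : Sun 5 → ℝ} (hν0 : ∀ x, 0 ≤ ν x) (hν1 : ∑ x, ν x = 1)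
    (hrow : 0 ≤ sahiE ν 5 (fun i => setInd (U (Finset.univ.erase i))))
    {a b c0 c1 c2 c3 c4 : ℝ} (ea : ν core = a) (eb : ν out = b) (e0 : ν (pet 0) = c0) (e1 : ν (pet 1) = c1) (e2 : ν (pet 2) = c2) (e3 : ν (pet 3) = c3) (e4 : ν (pet 4) = c4) :
    0 ≤ sahiE ν 4 ![setInd (U {0, 1, 2}), setInd (U {0, 1, 3}), setInd (U {0, 2, 3, 4}), setInd (U {1, 2, 3, 4})] := by
  have ha : 0 ≤ a := ea ▸ hν0 core
  have hb : 0 ≤ b := eb ▸ hν0 out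
  have h0 : 0 ≤ c0 := e0 ▸ hν0 (pet 0)
  have h1 : 0 ≤ c1 := e1 ▸ hν0 (pet 1)
  have h2 : 0 ≤ c2 := e2 ▸ hν0 (pet 2)
  have h3 : 0 ≤ c3 := e3 ▸ hν0 (pet 3)
  have h4 : 0 ≤ c4 := e4 ▸ hν0 (pet 4)
  have hx := FaceCertKernel.ctx15_get_nonneg (R := ℝ) ha hb h0 h1 h2 h3 h4 (le_refl (0:ℝ)) (le_refl (0:ℝ)) (le_refl (0:ℝ)) (le_refl (0:ℝ)) (le_refl (0:ℝ)) (le_refl (0:ℝ)) (le_refl (0:ℝ)) (le_refl (0:ℝ))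
  have htot : a + b + c0 + c1 + c2 + c3 + c4 = 1 := by subst ea eb e0 e1 e2 e3 e4; exact sum_one_eq5 hν1
  have hA : eA5.denote (FaceCertKernel.ctx15 a b c0 c1 c2 c3 c4 0 0 0 0 0 0 0 0 : Context ℝ) = a := by
    show (1:ℝ) - (b + c0 + c1 + c2 + c3 + c4) = a
    linarith
  have hchk : FaceCertKernel.subCheckP (FaceCertKernel.toPP (SunCert.subst0 eA5 (.mul eMul5_4 eT5_15)))
      (FaceCertKernel.toPP (SunCert.subst0 eA5 (.add eR5 eP5_15))) = true := by
    decide +kernel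
  have hid := FaceCertKernel.denote_eq_of_subCheckP (FaceCertKernel.ctx15 a b c0 c1 c2 c3 c4 0 0 0 0 0 0 0 0 : Context ℝ) _ _ hchk
  rw [FaceCertKernel.denote_toPP _ _ (by decide +kernel), FaceCertKernel.denote_toPP _ _ (by decide +kernel),
    SunCert.denote_subst0, SunCert.denote_subst0, hA, SunCert.denote_mul, SunCert.denote_add] at hid
  have hP : 0 ≤ eP5_15.denote (FaceCertKernel.ctx15 a b c0 c1 c2 c3 c4 0 0 0 0 0 0 0 0 : Context ℝ) := by
    rw [← FaceCertKernel.denote_toPP _ _ (by decide +kernel)]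
    exact FaceCertKernel.denote_nonneg_of_coeffsP _ hx _ (by decide +kernel)
  have hM : 0 < eMul5_4.denote (FaceCertKernel.ctx15 a b c0 c1 c2 c3 c4 0 0 0 0 0 0 0 0 : Context ℝ) := by
    show (0:ℝ) < (3 + a)
    positivity
  have hT : sahiE ν 4 ![setInd (U {0, 1, 2}), setInd (U {0, 1, 3}), setInd (U {0, 2, 3, 4}), setInd (U {1, 2, 3, 4})] = eT5_15.denote (FaceCertKernel.ctx15 a b c0 c1 c2 c3 c4 0 0 0 0 0 0 0 0 : Context ℝ) := by
    subst ea eb e0 e1 e2 e3 e4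
    rw [sahiE_four]
    have x0 : ex ν (setInd (U {0, 1, 2}) * setInd (U {0, 1, 3}) * setInd (U {0, 2, 3, 4}) * setInd (U {1, 2, 3, 4})) = ν out := by
      simp [ex_eq5, setInd_apply]
    have x1 : ex ν (setInd (U {0, 1, 2})) = ν out + ν (pet 0) + ν (pet 1) + ν (pet 2) := by
      simp [ex_eq5, setInd_apply]
    have x2 : ex ν (setInd (U {0, 1, 3}) * setInd (U {0, 2, 3, 4}) * setInd (U {1, 2, 3, 4})) = ν out + ν (pet 3) := by
      simp [ex_eq5, setInd_apply]
    have x3 : ex ν (setInd (U {0, 1, 3})) = ν out + ν (pet 0) + ν (pet 1) + ν (pet 3) := by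
      simp [ex_eq5, setInd_apply]
    have x4 : ex ν (setInd (U {0, 1, 2}) * setInd (U {0, 2, 3, 4}) * setInd (U {1, 2, 3, 4})) = ν out + ν (pet 2) := by
      simp [ex_eq5, setInd_apply]
    have x5 : ex ν (setInd (U {0, 2, 3, 4})) = ν out + ν (pet 0) + ν (pet 2) + ν (pet 3) + ν (pet 4) := by
      simp [ex_eq5, setInd_apply]
    have x6 : ex ν (setInd (U {0, 1, 2}) * setInd (U {0, 1, 3}) * setInd (U {1, 2, 3, 4})) = ν out + ν (pet 1) := by
      simp [ex_eq5, setInd_apply]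
    have x7 : ex ν (setInd (U {1, 2, 3, 4})) = ν out + ν (pet 1) + ν (pet 2) + ν (pet 3) + ν (pet 4) := by
      simp [ex_eq5, setInd_apply]
    have x8 : ex ν (setInd (U {0, 1, 2}) * setInd (U {0, 1, 3}) * setInd (U {0, 2, 3, 4})) = ν out + ν (pet 0) := by
      simp [ex_eq5, setInd_apply]
    have x9 : ex ν (setInd (U {0, 2, 3, 4}) * setInd (U {1, 2, 3, 4})) = ν out + ν (pet 2) + ν (pet 3) + ν (pet 4) := by
      simp [ex_eq5, setInd_apply]
    have x10 : ex ν (setInd (U {0, 1, 3}) * setInd (U {1, 2, 3, 4})) = ν out + ν (pet 1) + ν (pet 3) := by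
      simp [ex_eq5, setInd_apply]
    have x11 : ex ν (setInd (U {0, 1, 3}) * setInd (U {0, 2, 3, 4})) = ν out + ν (pet 0) + ν (pet 3) := by
      simp [ex_eq5, setInd_apply]
    have x12 : ex ν (setInd (U {0, 1, 2}) * setInd (U {1, 2, 3, 4})) = ν out + ν (pet 1) + ν (pet 2) := by
      simp [ex_eq5, setInd_apply]
    have x13 : ex ν (setInd (U {0, 1, 2}) * setInd (U {0, 2, 3, 4})) = ν out + ν (pet 0) + ν (pet 2) := by
      simp [ex_eq5, setInd_apply]
    have x14 : ex ν (setInd (U {0, 1, 2}) * setInd (U {0, 1, 3})) = ν out + ν (pet 0) + ν (pet 1) := by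
      simp [ex_eq5, setInd_apply]
    rw [x0, x1, x2, x3, x4, x5, x6, x7, x8, x9, x10, x11, x12, x13, x14]
    rfl
  have hR : sahiE ν 5 (fun i => setInd (U (Finset.univ.erase i))) = eR5.denote (FaceCertKernel.ctx15 a b c0 c1 c2 c3 c4 0 0 0 0 0 0 0 0 : Context ℝ) := by
    subst ea eb e0 e1 e2 e3 e4; exact row_eq5 ν
  rw [hR] at hrow
  rw [hT]
  exact (mul_nonneg_iff_of_pos_left hM).1 (by rw [hid]; exact add_nonneg hrow hP)

set_option maxHeartbeats 2000000 in
set_option maxRecDepth 100000 in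
/-- Co-singleton type 16 of `Sun 5` (index sets `[[0, 1, 2], [0, 1, 3, 4], [0, 2, 3, 4], [1, 2, 3, 4]]`): `E_4 ≥ 0` from the top row, by the kernel-checked domination identity
`(3 + a)·E_4 = E_5(row) + P`, `P ≥ 0` (cell masses abbreviated by `ea, eb, e_j`; instantiate with `rfl`). [this work] -/
theorem co5_16 {ν : Sun 5 → ℝ} (hν0 : ∀ x, 0 ≤ ν x) (hν1 : ∑ x, ν x = 1)
    (hrow : 0 ≤ sahiE ν 5 (fun i => setInd (U (Finset.univ.erase i))))
    {a b c0 c1 c2 c3 c4 : ℝ} (ea : ν core = a) (eb : ν out = b) (e0 : ν (pet 0) = c0) (e1 : ν (pet 1) = c1) (e2 : ν (pet 2) = c2) (e3 : ν (pet 3) = c3) (e4 : ν (pet 4) = c4) :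
    0 ≤ sahiE ν 4 ![setInd (U {0, 1, 2}), setInd (U {0, 1, 3, 4}), setInd (U {0, 2, 3, 4}), setInd (U {1, 2, 3, 4})] := by
  have ha : 0 ≤ a := ea ▸ hν0 core
  have hb : 0 ≤ b := eb ▸ hν0 out
  have h0 : 0 ≤ c0 := e0 ▸ hν0 (pet 0)
  have h1 : 0 ≤ c1 := e1 ▸ hν0 (pet 1)
  have h2 : 0 ≤ c2 := e2 ▸ hν0 (pet 2)
  have h3 : 0 ≤ c3 := e3 ▸ hν0 (pet 3)
  have h4 : 0 ≤ c4 := e4 ▸ hν0 (pet 4)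
  have hx := FaceCertKernel.ctx15_get_nonneg (R := ℝ) ha hb h0 h1 h2 h3 h4 (le_refl (0:ℝ)) (le_refl (0:ℝ)) (le_refl (0:ℝ)) (le_refl (0:ℝ)) (le_refl (0:ℝ)) (le_refl (0:ℝ)) (le_refl (0:ℝ)) (le_refl (0:ℝ))
  have htot : a + b + c0 + c1 + c2 + c3 + c4 = 1 := by subst ea eb e0 e1 e2 e3 e4; exact sum_one_eq5 hν1
  have hA : eA5.denote (FaceCertKernel.ctx15 a b c0 c1 c2 c3 c4 0 0 0 0 0 0 0 0 : Context ℝ) = a := by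
    show (1:ℝ) - (b + c0 + c1 + c2 + c3 + c4) = a
    linarith
  have hchk : FaceCertKernel.subCheckP (FaceCertKernel.toPP (SunCert.subst0 eA5 (.mul eMul5_4 eT5_16)))
      (FaceCertKernel.toPP (SunCert.subst0 eA5 (.add eR5 eP5_16))) = true := by
    decide +kernel
  have hid := FaceCertKernel.denote_eq_of_subCheckP (FaceCertKernel.ctx15 a b c0 c1 c2 c3 c4 0 0 0 0 0 0 0 0 : Context ℝ) _ _ hchk
  rw [FaceCertKernel.denote_toPP _ _ (by decide +kernel), FaceCertKernel.denote_toPP _ _ (by decide +kernel),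
    SunCert.denote_subst0, SunCert.denote_subst0, hA, SunCert.denote_mul, SunCert.denote_add] at hid
  have hP : 0 ≤ eP5_16.denote (FaceCertKernel.ctx15 a b c0 c1 c2 c3 c4 0 0 0 0 0 0 0 0 : Context ℝ) := by
    rw [← FaceCertKernel.denote_toPP _ _ (by decide +kernel)]
    exact FaceCertKernel.denote_nonneg_of_coeffsP _ hx _ (by decide +kernel)
  have hM : 0 < eMul5_4.denote (FaceCertKernel.ctx15 a b c0 c1 c2 c3 c4 0 0 0 0 0 0 0 0 : Context ℝ) := by
    show (0:ℝ) < (3 + a)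
    positivity
  have hT : sahiE ν 4 ![setInd (U {0, 1, 2}), setInd (U {0, 1, 3, 4}), setInd (U {0, 2, 3, 4}), setInd (U {1, 2, 3, 4})] = eT5_16.denote (FaceCertKernel.ctx15 a b c0 c1 c2 c3 c4 0 0 0 0 0 0 0 0 : Context ℝ) := by
    subst ea eb e0 e1 e2 e3 e4
    rw [sahiE_four]
    have x0 : ex ν (setInd (U {0, 1, 2}) * setInd (U {0, 1, 3, 4}) * setInd (U {0, 2, 3, 4}) * setInd (U {1, 2, 3, 4})) = ν out := by
      simp [ex_eq5, setInd_apply]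
    have x1 : ex ν (setInd (U {0, 1, 2})) = ν out + ν (pet 0) + ν (pet 1) + ν (pet 2) := by
      simp [ex_eq5, setInd_apply]
    have x2 : ex ν (setInd (U {0, 1, 3, 4}) * setInd (U {0, 2, 3, 4}) * setInd (U {1, 2, 3, 4})) = ν out + ν (pet 3) + ν (pet 4) := by
      simp [ex_eq5, setInd_apply]
    have x3 : ex ν (setInd (U {0, 1, 3, 4})) = ν out + ν (pet 0) + ν (pet 1) + ν (pet 3) + ν (pet 4) := by
      simp [ex_eq5, setInd_apply]
    have x4 : ex ν (setInd (U {0, 1, 2}) * setInd (U {0, 2, 3, 4}) * setInd (U {1, 2, 3, 4})) = ν out + ν (pet 2) := by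
      simp [ex_eq5, setInd_apply]
    have x5 : ex ν (setInd (U {0, 2, 3, 4})) = ν out + ν (pet 0) + ν (pet 2) + ν (pet 3) + ν (pet 4) := by
      simp [ex_eq5, setInd_apply]
    have x6 : ex ν (setInd (U {0, 1, 2}) * setInd (U {0, 1, 3, 4}) * setInd (U {1, 2, 3, 4})) = ν out + ν (pet 1) := by
      simp [ex_eq5, setInd_apply]
    have x7 : ex ν (setInd (U {1, 2, 3, 4})) = ν out + ν (pet 1) + ν (pet 2) + ν (pet 3) + ν (pet 4) := by
      simp [ex_eq5, setInd_apply]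
    have x8 : ex ν (setInd (U {0, 1, 2}) * setInd (U {0, 1, 3, 4}) * setInd (U {0, 2, 3, 4})) = ν out + ν (pet 0) := by
      simp [ex_eq5, setInd_apply]
    have x9 : ex ν (setInd (U {0, 2, 3, 4}) * setInd (U {1, 2, 3, 4})) = ν out + ν (pet 2) + ν (pet 3) + ν (pet 4) := by
      simp [ex_eq5, setInd_apply]
    have x10 : ex ν (setInd (U {0, 1, 3, 4}) * setInd (U {1, 2, 3, 4})) = ν out + ν (pet 1) + ν (pet 3) + ν (pet 4) := by
      simp [ex_eq5, setInd_apply]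
    have x11 : ex ν (setInd (U {0, 1, 3, 4}) * setInd (U {0, 2, 3, 4})) = ν out + ν (pet 0) + ν (pet 3) + ν (pet 4) := by
      simp [ex_eq5, setInd_apply]
    have x12 : ex ν (setInd (U {0, 1, 2}) * setInd (U {1, 2, 3, 4})) = ν out + ν (pet 1) + ν (pet 2) := by
      simp [ex_eq5, setInd_apply]
    have x13 : ex ν (setInd (U {0, 1, 2}) * setInd (U {0, 2, 3, 4})) = ν out + ν (pet 0) + ν (pet 2) := by
      simp [ex_eq5, setInd_apply]
    have x14 : ex ν (setInd (U {0, 1, 2}) * setInd (U {0, 1, 3, 4})) = ν out + ν (pet 0) + ν (pet 1) := by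
      simp [ex_eq5, setInd_apply]
    rw [x0, x1, x2, x3, x4, x5, x6, x7, x8, x9, x10, x11, x12, x13, x14]
    rfl
  have hR : sahiE ν 5 (fun i => setInd (U (Finset.univ.erase i))) = eR5.denote (FaceCertKernel.ctx15 a b c0 c1 c2 c3 c4 0 0 0 0 0 0 0 0 : Context ℝ) := by
    subst ea eb e0 e1 e2 e3 e4; exact row_eq5 ν
  rw [hR] at hrow
  rw [hT]
  exact (mul_nonneg_iff_of_pos_left hM).1 (by rw [hid]; exact add_nonneg hrow hP)

set_option maxHeartbeats 2000000 in
set_option maxRecDepth 100000 in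
/-- Co-singleton type 17 of `Sun 5` (index sets `[[0, 1, 2, 4], [0, 1, 3, 4], [0, 2, 3, 4], [1, 2, 3, 4]]`): `E_4 ≥ 0` from the top row, by the kernel-checked domination identity
`(3 + a)·E_4 = E_5(row) + P`, `P ≥ 0` (cell masses abbreviated by `ea, eb, e_j`; instantiate with `rfl`). [this work] -/
theorem co5_17 {ν : Sun 5 → ℝ} (hν0 : ∀ x, 0 ≤ ν x) (hν1 : ∑ x, ν x = 1)
    (hrow : 0 ≤ sahiE ν 5 (fun i => setInd (U (Finset.univ.erase i))))
    {a b c0 c1 c2 c3 c4 : ℝ} (ea : ν core = a) (eb : ν out = b) (e0 : ν (pet 0) = c0) (e1 : ν (pet 1) = c1) (e2 : ν (pet 2) = c2) (e3 : ν (pet 3) = c3) (e4 : ν (pet 4) = c4) :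
    0 ≤ sahiE ν 4 ![setInd (U {0, 1, 2, 4}), setInd (U {0, 1, 3, 4}), setInd (U {0, 2, 3, 4}), setInd (U {1, 2, 3, 4})] := by
  have ha : 0 ≤ a := ea ▸ hν0 core
  have hb : 0 ≤ b := eb ▸ hν0 out
  have h0 : 0 ≤ c0 := e0 ▸ hν0 (pet 0)
  have h1 : 0 ≤ c1 := e1 ▸ hν0 (pet 1)
  have h2 : 0 ≤ c2 := e2 ▸ hν0 (pet 2)
  have h3 : 0 ≤ c3 := e3 ▸ hν0 (pet 3)
  have h4 : 0 ≤ c4 := e4 ▸ hν0 (pet 4)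
  have hx := FaceCertKernel.ctx15_get_nonneg (R := ℝ) ha hb h0 h1 h2 h3 h4 (le_refl (0:ℝ)) (le_refl (0:ℝ)) (le_refl (0:ℝ)) (le_refl (0:ℝ)) (le_refl (0:ℝ)) (le_refl (0:ℝ)) (le_refl (0:ℝ)) (le_refl (0:ℝ))
  have htot : a + b + c0 + c1 + c2 + c3 + c4 = 1 := by subst ea eb e0 e1 e2 e3 e4; exact sum_one_eq5 hν1
  have hA : eA5.denote (FaceCertKernel.ctx15 a b c0 c1 c2 c3 c4 0 0 0 0 0 0 0 0 : Context ℝ) = a := by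
    show (1:ℝ) - (b + c0 + c1 + c2 + c3 + c4) = a
    linarith
  have hchk : FaceCertKernel.subCheckP (FaceCertKernel.toPP (SunCert.subst0 eA5 (.mul eMul5_4 eT5_17)))
      (FaceCertKernel.toPP (SunCert.subst0 eA5 (.add eR5 eP5_17))) = true := by
    decide +kernel
  have hid := FaceCertKernel.denote_eq_of_subCheckP (FaceCertKernel.ctx15 a b c0 c1 c2 c3 c4 0 0 0 0 0 0 0 0 : Context ℝ) _ _ hchk
  rw [FaceCertKernel.denote_toPP _ _ (by decide +kernel), FaceCertKernel.denote_toPP _ _ (by decide +kernel),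
    SunCert.denote_subst0, SunCert.denote_subst0, hA, SunCert.denote_mul, SunCert.denote_add] at hid
  have hP : 0 ≤ eP5_17.denote (FaceCertKernel.ctx15 a b c0 c1 c2 c3 c4 0 0 0 0 0 0 0 0 : Context ℝ) := by
    rw [← FaceCertKernel.denote_toPP _ _ (by decide +kernel)]
    exact FaceCertKernel.denote_nonneg_of_coeffsP _ hx _ (by decide +kernel)
  have hM : 0 < eMul5_4.denote (FaceCertKernel.ctx15 a b c0 c1 c2 c3 c4 0 0 0 0 0 0 0 0 : Context ℝ) := by
    show (0:ℝ) < (3 + a)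
    positivity
  have hT : sahiE ν 4 ![setInd (U {0, 1, 2, 4}), setInd (U {0, 1, 3, 4}), setInd (U {0, 2, 3, 4}), setInd (U {1, 2, 3, 4})] = eT5_17.denote (FaceCertKernel.ctx15 a b c0 c1 c2 c3 c4 0 0 0 0 0 0 0 0 : Context ℝ) := by
    subst ea eb e0 e1 e2 e3 e4
    rw [sahiE_four]
    have x0 : ex ν (setInd (U {0, 1, 2, 4}) * setInd (U {0, 1, 3, 4}) * setInd (U {0, 2, 3, 4}) * setInd (U {1, 2, 3, 4})) = ν out + ν (pet 4) := by
      simp [ex_eq5, setInd_apply]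
    have x1 : ex ν (setInd (U {0, 1, 2, 4})) = ν out + ν (pet 0) + ν (pet 1) + ν (pet 2) + ν (pet 4) := by
      simp [ex_eq5, setInd_apply]
    have x2 : ex ν (setInd (U {0, 1, 3, 4}) * setInd (U {0, 2, 3, 4}) * setInd (U {1, 2, 3, 4})) = ν out + ν (pet 3) + ν (pet 4) := by
      simp [ex_eq5, setInd_apply]
    have x3 : ex ν (setInd (U {0, 1, 3, 4})) = ν out + ν (pet 0) + ν (pet 1) + ν (pet 3) + ν (pet 4) := by
      simp [ex_eq5, setInd_apply]
    have x4 : ex ν (setInd (U {0, 1, 2, 4}) * setInd (U {0, 2, 3, 4}) * setInd (U {1, 2, 3, 4})) = ν out + ν (pet 2) + ν (pet 4) := by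
      simp [ex_eq5, setInd_apply]
    have x5 : ex ν (setInd (U {0, 2, 3, 4})) = ν out + ν (pet 0) + ν (pet 2) + ν (pet 3) + ν (pet 4) := by
      simp [ex_eq5, setInd_apply]
    have x6 : ex ν (setInd (U {0, 1, 2, 4}) * setInd (U {0, 1, 3, 4}) * setInd (U {1, 2, 3, 4})) = ν out + ν (pet 1) + ν (pet 4) := by
      simp [ex_eq5, setInd_apply]
    have x7 : ex ν (setInd (U {1, 2, 3, 4})) = ν out + ν (pet 1) + ν (pet 2) + ν (pet 3) + ν (pet 4) := by
      simp [ex_eq5, setInd_apply]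
    have x8 : ex ν (setInd (U {0, 1, 2, 4}) * setInd (U {0, 1, 3, 4}) * setInd (U {0, 2, 3, 4})) = ν out + ν (pet 0) + ν (pet 4) := by
      simp [ex_eq5, setInd_apply]
    have x9 : ex ν (setInd (U {0, 2, 3, 4}) * setInd (U {1, 2, 3, 4})) = ν out + ν (pet 2) + ν (pet 3) + ν (pet 4) := by
      simp [ex_eq5, setInd_apply]
    have x10 : ex ν (setInd (U {0, 1, 3, 4}) * setInd (U {1, 2, 3, 4})) = ν out + ν (pet 1) + ν (pet 3) + ν (pet 4) := by
      simp [ex_eq5, setInd_apply]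
    have x11 : ex ν (setInd (U {0, 1, 3, 4}) * setInd (U {0, 2, 3, 4})) = ν out + ν (pet 0) + ν (pet 3) + ν (pet 4) := by
      simp [ex_eq5, setInd_apply]
    have x12 : ex ν (setInd (U {0, 1, 2, 4}) * setInd (U {1, 2, 3, 4})) = ν out + ν (pet 1) + ν (pet 2) + ν (pet 4) := by
      simp [ex_eq5, setInd_apply]
    have x13 : ex ν (setInd (U {0, 1, 2, 4}) * setInd (U {0, 2, 3, 4})) = ν out + ν (pet 0) + ν (pet 2) + ν (pet 4) := by
      simp [ex_eq5, setInd_apply]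
    have x14 : ex ν (setInd (U {0, 1, 2, 4}) * setInd (U {0, 1, 3, 4})) = ν out + ν (pet 0) + ν (pet 1) + ν (pet 4) := by
      simp [ex_eq5, setInd_apply]
    rw [x0, x1, x2, x3, x4, x5, x6, x7, x8, x9, x10, x11, x12, x13, x14]
    rfl
  have hR : sahiE ν 5 (fun i => setInd (U (Finset.univ.erase i))) = eR5.denote (FaceCertKernel.ctx15 a b c0 c1 c2 c3 c4 0 0 0 0 0 0 0 0 : Context ℝ) := by
    subst ea eb e0 e1 e2 e3 e4; exact row_eq5 ν
  rw [hR] at hrow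
  rw [hT]
  exact (mul_nonneg_iff_of_pos_left hM).1 (by rw [hid]; exact add_nonneg hrow hP)

end Sun
end Summit.CriticalPhenomena.PercolationContinuityZ3.Theorems.SahiDeltaSystem
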